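import Literature.MathematicalPhysics.QuantumLattice.GroundStateSpinReflectionPositivityHubbard
import Literature.MathematicalPhysics.QuantumLattice.HubbardBootstrapCertificateResidual
import Summits.HubbardSuperconductivity.HubbardLadder.HubbardSingletRows
import HarnessLib

/-!
# Certificate rows with Lieb's spin-reflection-positivity Gram blocks (`liebgram`, `liebgram_flip`)

HONEST FRAMING: ladder R1–R4 with certified numbers; no claim on H/H₀. Family `hubbard`, cell
`pub-hubbard` (solver-side row menu for the certificate pipeline at half filling, `n = 1`).

The Literature file `GroundStateSpinReflectionPositivityHubbard` proves (Lieb, PRL 62 (1989) 1201,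
proof of Theorem 2; Tian, J. Stat. Phys. 116 (2004) 629) that in THE half-filled ground state `ψ`
of `hubbardTorus 2 L t U` (`L` even, `t ≠ 0`, `U > 0`) the matrices
`[⟨ψ, u(w a) d̃(w b) ψ⟩]_{ab}` and `[⟨ψ, d(w a) ũ(w b) ψ⟩]_{ab}` are positive semidefinite
(`hubbardTorus_liebGram_posSemidef`, `…_flip`), where `u(l) = Π_{(i,j) ∈ l} c†_{i↑} c_{j↑}`
(`LiebTwo.upWord`), `d̃(l) = Π_{(k,l) ∈ l} ε_k ε_l c_{k↓} c†_{l↓}` (`LiebTwo.shibaDownWord`,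
`ε = torusSign = (-1)^{x₁+x₂}`) and `d`, `ũ` are their spin flips. Hence for dual matrices
`G, G' ⪰ 0` the LIEB FORMS `Σ_ab G_ab u(w a) d̃(w b)` (`LiebTwo.liebForm torusSign G w`) and
`Σ_ab G'_ab d(w' a) ũ(w' b)` (`LiebTwo.liebFormFlip torusSign G' w'`) have nonnegative
ground-state expectation, and may be added to the nonnegative side of a certificate identity
exactly like an SOS Gram form (Kull–Schuch–Dive–Navascués, PRX 14 (2024) 021008 §5.3).

This file states the resulting ROWS in the shape of `HubbardSingletRows` (menu
`singletSectorAnn (L²) = ![N̂ − L², S^z, S⁺, (S⁺)ᴴ]` of annihilators of the singlet ground state)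
with, in addition, the two Lieb forms and a residual `R` with `R + δ·1 ⪰ 0` (or a monomial
residual `Σ_k a_k M_k`, `δ = Σ_k ‖a_k‖`, `Matrix.posSemidef_sum_smul_add_of_isContraction`):

* `groundEnergyAt_halfFilling_ge_of_certificate_liebGram` (R1): `H − c·1 = SOS + null + (liebForm
  + liebFormFlip + R)` ⟹ `c − δ ≤ E₀(L²)`; `…_liebGram_residual`: monomial residual,
  `c − Σ‖a_k‖ ≤ E₀(L²)`;
* `re_expect_halfFilledGS_ge_of_windowCertificate_liebGram` (R2): `V − c·1 = SOS + null +
  μ (E_up − H) + ν (H − E_lo) + (liebForm + liebFormFlip + R)`, `μ, ν ≥ 0`,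
  `E_lo ≤ E₀(L²) ≤ E_up` ⟹ `c − δ ≤ Re ⟨ψ, V ψ⟩` for every normalised `(L², S^z = 0)` sector
  ground state `ψ`; `…_le_…`: the upper-bound form.

NOTE for certificate files at the concrete torus: elaborate the identity with the order-derived
`DecidableEq (FermionTorus 2 L)` (`LinearOrder.toDecidableEq`, the local instance of this file and
of `HubbardTorusLocalCertificate`), the instance all orbital-generic lemmas carry.

References: [cite: LiebPRL1989, proof of Theorem 2]; Tian, J. Stat. Phys. 116 (2004) 629 (bib
`Tian2004`, cite-only); [cite: KullEtAl2024, §5.3]; [cite: Han2020Bootstrap, §2 eq. (3)]; [cite: WangEtAl2024, §3 eq. (4)].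
-/

noncomputable section

namespace Summit.HubbardSuperconductivity.HubbardLadder

open Matrix Finset Literature.MathematicalPhysics.QuantumLattice
  Literature.MathematicalPhysics.QuantumLattice.LiebTwo
  Literature.MathematicalPhysics.QuantumManyBody.StateRelaxation
open scoped ComplexOrder MatrixOrder

/-- The vector state of `StateRelaxationDuality` under an unambiguous local name (the opened
namespace `QuantumLattice` has a `vectorState` of its own, `CorrelationLightCone`). -/
local notation "srState" => Literature.MathematicalPhysics.QuantumManyBody.StateRelaxation.vectorState

/-- Unfolding `srState`. [folklore] -/
private theorem srState_apply {n : Type*} [Fintype n] (v : n → ℂ) (O : Matrix n n ℂ) :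
    srState v O = star v ⬝ᵥ O *ᵥ v := rfl

/-- `-δ ≤ Re ⟨v, R v⟩` for `R + δ·1 ⪰ 0` and a unit vector `v`. [folklore] -/
private theorem re_srState_ge_of_posSemidef_add {n : Type*} [Fintype n] [DecidableEq n]
    {v : n → ℂ} (hv : star v ⬝ᵥ v = 1) {R : Matrix n n ℂ} {δ : ℝ}
    (hR : (R + (δ : ℂ) • (1 : Matrix n n ℂ)).PosSemidef) : -δ ≤ (srState v R).re := by
  have h := hR.dotProduct_mulVec_nonneg v
  rw [add_mulVec, dotProduct_add, Matrix.smul_mulVec, one_mulVec, dotProduct_smul, hv,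
    smul_eq_mul, mul_one] at h
  obtain ⟨hre, -⟩ := Complex.nonneg_iff.mp h
  rw [Complex.add_re, Complex.ofReal_re] at hre
  rw [srState_apply]; linarith

section Torus

variable (L : ℕ) [NeZero L]

/-- (Local to this file, as in `HubbardTorusLocalCertificate` / `DopedRVBState`.) Equality of torus
sites is decided through the LINEAR ORDER — the instance every orbital-generic lemma of the tree
(`isContraction_prod_ladder`, the Jordan–Wigner matrices, …) carries once specialised to
`Λ = FermionTorus 2 L`; the structural `Lex/Pi/Fin` instance found at the concrete type is only
propositionally equal to it. No library instance is overridden outside this file. [folklore] -/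
local instance (priority := high) instDecidableEqFermionTorusLiebRows :
    DecidableEq (FermionTorus 2 L) :=
  LinearOrder.toDecidableEq

variable {m : Type*} [Fintype m] [DecidableEq m]

omit [NeZero L] in
/-- The null part of a row evaluated in a half-filled singlet vector vanishes:
commutators with `H` in an eigenvector, menu ideal terms. [folklore] -/
private theorem srState_null_eq_zero {t U : ℝ} {ψ : Fock (Orb (FermionTorus 2 L))}
    (hN : IsNParticle (L ^ 2) ψ) (hS : spinSq *ᵥ ψ = 0)
    (hHψ : hubbardTorus 2 L t U *ᵥ ψ =
      ((groundEnergyAt (fermionTorusGraph 2 L) t U (L ^ 2) : ℝ) : ℂ) • ψ)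
    {κ : Type*} (s : Finset κ)
    (X : κ → Matrix (Finset (Orb (FermionTorus 2 L))) (Finset (Orb (FermionTorus 2 L))) ℂ)
    {ι : Type*} (t' : Finset ι)
    (Y Y' : ι → Matrix (Finset (Orb (FermionTorus 2 L))) (Finset (Orb (FermionTorus 2 L))) ℂ)
    (a a' : ι → Fin 4) :
    srState ψ (∑ k ∈ s, (hubbardTorus 2 L t U * X k - X k * hubbardTorus 2 L t U) +
        ∑ q ∈ t', (Y q * singletSectorAnn (L ^ 2) (a q) + singletSectorAnn (L ^ 2) (a' q) * Y' q)) =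
      0 := by
  have hHerm : (hubbardTorus 2 L t U).IsHermitian :=
    LiebThm1.hamiltonian_isHermitian (fermionTorusGraph 2 L) t U
  have h1 : ∀ k ∈ s, srState ψ (hubbardTorus 2 L t U * X k - X k * hubbardTorus 2 L t U) = 0 :=
    fun k _ => vectorState_commutator hHerm hHψ (X k)
  have h2 : ∀ q ∈ t',
      srState ψ (Y q * singletSectorAnn (L ^ 2) (a q) + singletSectorAnn (L ^ 2) (a' q) * Y' q) =
        0 := fun q _ => by
    rw [map_add, vectorState_mul_of_mulVec_eq_zero ψ (Y q)
        (singletSectorAnn_mulVec_eq_zero (L ^ 2) hN hS (a q)),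
      vectorState_mul_of_conjTranspose_mulVec_eq_zero ψ (Y' q)
        (conjTranspose_singletSectorAnn_mulVec_eq_zero (L ^ 2) hN hS (a' q)), add_zero]
  rw [map_add, map_sum, map_sum, Finset.sum_eq_zero h1, Finset.sum_eq_zero h2, add_zero]

/-- **Energy row with Lieb Gram blocks and a residual (R1 rows at `n = 1`).** For even `L`,
`t ≠ 0`, `U > 0`: an identity
`H − c·1 = Σ Λᵢⱼ Oᵢᴴ Oⱼ + (Σ_k (H X_k − X_k H) + Σ_q (Y_q Z_{a q} + Z_{a' q} Y'_q))
  + (liebForm ε G w + liebFormFlip ε G' w' + R)`, `Λ, G, G' ⪰ 0`, `Z` from the menu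
`singletSectorAnn (L²)`, `R + δ·1 ⪰ 0`, proves `c − δ ≤ E₀(L²) = groundEnergyAt (fermionTorusGraph
2 L) t U (L²)` — evaluate in THE half-filled ground state, a singlet with Lieb's positive definite
coefficient matrix. [cite: LiebPRL1989, proof of Theorem 2] [cite: KullEtAl2024, §5.3] -/
theorem groundEnergyAt_halfFilling_ge_of_certificate_liebGram (hL : Even L) {t U : ℝ} (ht : t ≠ 0)
    (hU : 0 < U) {Λm : Matrix m m ℂ} (hΛ : Λm.PosSemidef)
    (O : m → Matrix (Finset (Orb (FermionTorus 2 L))) (Finset (Orb (FermionTorus 2 L))) ℂ)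
    {κ : Type*} (s : Finset κ)
    (X : κ → Matrix (Finset (Orb (FermionTorus 2 L))) (Finset (Orb (FermionTorus 2 L))) ℂ)
    {ι : Type*} (t' : Finset ι)
    (Y Y' : ι → Matrix (Finset (Orb (FermionTorus 2 L))) (Finset (Orb (FermionTorus 2 L))) ℂ)
    (a a' : ι → Fin 4)
    {κ₁ : Type*} [Fintype κ₁] {Gm : Matrix κ₁ κ₁ ℂ} (hGm : Gm.PosSemidef)
    (w : κ₁ → List (FermionTorus 2 L × FermionTorus 2 L))
    {κ₂ : Type*} [Fintype κ₂] {Gm' : Matrix κ₂ κ₂ ℂ} (hGm' : Gm'.PosSemidef)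
    (w' : κ₂ → List (FermionTorus 2 L × FermionTorus 2 L))
    {R : Matrix (Finset (Orb (FermionTorus 2 L))) (Finset (Orb (FermionTorus 2 L))) ℂ} {δ : ℝ}
    (hR : (R + (δ : ℂ) • (1 : Matrix (Finset (Orb (FermionTorus 2 L))) _ ℂ)).PosSemidef) {c : ℝ}
    (hcert : hubbardTorus 2 L t U - (c : ℂ) • 1 =
      gramForm Λm O + (∑ k ∈ s, (hubbardTorus 2 L t U * X k - X k * hubbardTorus 2 L t U) +
        ∑ q ∈ t', (Y q * singletSectorAnn (L ^ 2) (a q) + singletSectorAnn (L ^ 2) (a' q) * Y' q)) +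
        (liebForm torusSign Gm w + liebFormFlip torusSign Gm' w' + R)) :
    c - δ ≤ groundEnergyAt (fermionTorusGraph 2 L) t U (L ^ 2) := by
  classical
  obtain ⟨ψ, hψK, h1, hHψ, hS, -, -⟩ :=
    LiebHalfFilled.hubbardTorus_exists_unit_groundState (L := L) hL ht hU
  have hN : IsNParticle (L ^ 2) ψ := ((mem_szSector_iff _ _ _).1 hψK).1
  have hHψ' : hubbardTorus 2 L t U *ᵥ ψ =
      ((groundEnergyAt (fermionTorusGraph 2 L) t U (L ^ 2) : ℝ) : ℂ) • ψ := hHψ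
  have hpos : ∀ x, 0 ≤ srState ψ (star x * x) := fun x => vectorState_nonneg ψ x
  have hone : srState ψ 1 = 1 := by rw [srState_apply, one_mulVec, h1]
  have hn := srState_null_eq_zero L hN hS hHψ' s X t' Y Y' a a'
  have hP : 0 ≤ (srState ψ (liebForm torusSign Gm w)).re := by
    rw [srState_apply]
    exact (Complex.nonneg_iff.mp (hubbardTorus_liebForm_expect_nonneg hL ht hU hN hHψ' hGm w)).1
  have hP' : 0 ≤ (srState ψ (liebFormFlip torusSign Gm' w')).re := by
    rw [srState_apply]
    exact (Complex.nonneg_iff.mp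
      (hubbardTorus_liebFormFlip_expect_nonneg hL ht hU hN hHψ' hGm' w')).1
  have hRre := re_srState_ge_of_posSemidef_add h1 hR
  have hr : -δ ≤ (srState ψ (liebForm torusSign Gm w + liebFormFlip torusSign Gm' w' + R)).re := by
    simp only [map_add, Complex.add_re]
    linarith
  have h := le_re_map_of_certificate_residual (srState ψ) hpos hone hΛ O hn hr hcert
  rwa [srState_apply, hHψ', dotProduct_smul, h1, smul_eq_mul, mul_one, Complex.ofReal_re] at h

/-- **Energy row with Lieb Gram blocks and a monomial residual** (the form a rounded certificate
has): as `groundEnergyAt_halfFilling_ge_of_certificate_liebGram` with residual `Σ_k a_k M_k`,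
`M_k` fermionic monomials (products of creation/annihilation matrices), `Σ_k a_k M_k` Hermitian;
proves `c − Σ_k ‖a_k‖ ≤ E₀(L²)`. [cite: LiebPRL1989, proof of Theorem 2]
[cite: Han2020Bootstrap, §2 eq. (3)] -/
theorem groundEnergyAt_halfFilling_ge_of_certificate_liebGram_residual (hL : Even L) {t U : ℝ}
    (ht : t ≠ 0) (hU : 0 < U) {Λm : Matrix m m ℂ} (hΛ : Λm.PosSemidef)
    (O : m → Matrix (Finset (Orb (FermionTorus 2 L))) (Finset (Orb (FermionTorus 2 L))) ℂ)
    {κ : Type*} (s : Finset κ)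
    (X : κ → Matrix (Finset (Orb (FermionTorus 2 L))) (Finset (Orb (FermionTorus 2 L))) ℂ)
    {ι : Type*} (t' : Finset ι)
    (Y Y' : ι → Matrix (Finset (Orb (FermionTorus 2 L))) (Finset (Orb (FermionTorus 2 L))) ℂ)
    (a a' : ι → Fin 4)
    {κ₁ : Type*} [Fintype κ₁] {Gm : Matrix κ₁ κ₁ ℂ} (hGm : Gm.PosSemidef)
    (w : κ₁ → List (FermionTorus 2 L × FermionTorus 2 L))
    {κ₂ : Type*} [Fintype κ₂] {Gm' : Matrix κ₂ κ₂ ℂ} (hGm' : Gm'.PosSemidef)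
    (w' : κ₂ → List (FermionTorus 2 L × FermionTorus 2 L))
    {κ₃ : Type*} (wr : Finset κ₃) (ar : κ₃ → ℂ)
    (word : κ₃ → List (Orb (FermionTorus 2 L) × Bool))
    (hherm : (∑ k ∈ wr, ar k • ((word k).map fun p : Orb (FermionTorus 2 L) × Bool =>
      if p.2 then creation p.1 else annihilation p.1).prod).IsHermitian)
    {c : ℝ}
    (hcert : hubbardTorus 2 L t U - (c : ℂ) • 1 =
      gramForm Λm O + (∑ k ∈ s, (hubbardTorus 2 L t U * X k - X k * hubbardTorus 2 L t U) +
        ∑ q ∈ t', (Y q * singletSectorAnn (L ^ 2) (a q) + singletSectorAnn (L ^ 2) (a' q) * Y' q)) +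
        (liebForm torusSign Gm w + liebFormFlip torusSign Gm' w' +
          ∑ k ∈ wr, ar k • ((word k).map fun p : Orb (FermionTorus 2 L) × Bool =>
            if p.2 then creation p.1 else annihilation p.1).prod)) :
    c - ∑ k ∈ wr, ‖ar k‖ ≤ groundEnergyAt (fermionTorusGraph 2 L) t U (L ^ 2) :=
  groundEnergyAt_halfFilling_ge_of_certificate_liebGram L hL ht hU hΛ O s X t' Y Y' a a' hGm w hGm' w'
    (R := ∑ k ∈ wr, ar k • ((word k).map fun p : Orb (FermionTorus 2 L) × Bool =>
      if p.2 then creation p.1 else annihilation p.1).prod)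
    (δ := ∑ k ∈ wr, ‖ar k‖)
    (Matrix.posSemidef_sum_smul_add_of_isContraction wr
      (fun k => ((word k).map fun p : Orb (FermionTorus 2 L) × Bool =>
        if p.2 then creation p.1 else annihilation p.1).prod)
      (fun k _ => isContraction_prod_ladder (word k)) ar hherm)
    hcert

/-- **Observable WINDOW row with Lieb Gram blocks (R2 rows at `n = 1`; the R2 ⇒ R3 edge shape).**
With an energy window `μ (E_up − H) + ν (H − E_lo)`, `μ, ν ≥ 0`, `E_lo ≤ E₀(L²) ≤ E_up`
(certified bounds), the null terms of `groundEnergyAt_halfFilling_ge_of_certificate_liebGram`,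
Lieb forms with `G, G' ⪰ 0` and a residual `R + δ·1 ⪰ 0`, an identity for `V − c·1` proves
`c − δ ≤ Re ⟨ψ, V ψ⟩` for every normalised `(L², S^z = 0)` sector ground state `ψ` (at half
filling: THE ground state). [cite: LiebPRL1989, proof of Theorem 2] [cite: WangEtAl2024, §3 eq. (4)]
[cite: KullEtAl2024, §5.3] -/
theorem re_expect_halfFilledGS_ge_of_windowCertificate_liebGram (hL : Even L) {t U : ℝ}
    (ht : t ≠ 0) (hU : 0 < U) {Λm : Matrix m m ℂ} (hΛ : Λm.PosSemidef)
    (O : m → Matrix (Finset (Orb (FermionTorus 2 L))) (Finset (Orb (FermionTorus 2 L))) ℂ)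
    {κ : Type*} (s : Finset κ)
    (X : κ → Matrix (Finset (Orb (FermionTorus 2 L))) (Finset (Orb (FermionTorus 2 L))) ℂ)
    {ι : Type*} (t' : Finset ι)
    (Y Y' : ι → Matrix (Finset (Orb (FermionTorus 2 L))) (Finset (Orb (FermionTorus 2 L))) ℂ)
    (a a' : ι → Fin 4)
    {κ₁ : Type*} [Fintype κ₁] {Gm : Matrix κ₁ κ₁ ℂ} (hGm : Gm.PosSemidef)
    (w : κ₁ → List (FermionTorus 2 L × FermionTorus 2 L))
    {κ₂ : Type*} [Fintype κ₂] {Gm' : Matrix κ₂ κ₂ ℂ} (hGm' : Gm'.PosSemidef)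
    (w' : κ₂ → List (FermionTorus 2 L × FermionTorus 2 L))
    {R : Matrix (Finset (Orb (FermionTorus 2 L))) (Finset (Orb (FermionTorus 2 L))) ℂ} {δ : ℝ}
    (hR : (R + (δ : ℂ) • (1 : Matrix (Finset (Orb (FermionTorus 2 L))) _ ℂ)).PosSemidef)
    {V : Matrix (Finset (Orb (FermionTorus 2 L))) (Finset (Orb (FermionTorus 2 L))) ℂ}
    {Eup Elo μ ν c : ℝ} (hμ : 0 ≤ μ) (hν : 0 ≤ ν)
    (hup : groundEnergyAt (fermionTorusGraph 2 L) t U (L ^ 2) ≤ Eup)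
    (hlo : Elo ≤ groundEnergyAt (fermionTorusGraph 2 L) t U (L ^ 2))
    (hcert : V - (c : ℂ) • 1 =
      gramForm Λm O + (∑ k ∈ s, (hubbardTorus 2 L t U * X k - X k * hubbardTorus 2 L t U) +
        ∑ q ∈ t', (Y q * singletSectorAnn (L ^ 2) (a q) + singletSectorAnn (L ^ 2) (a' q) * Y' q)) +
        ((μ : ℂ) • ((Eup : ℂ) • 1 - hubbardTorus 2 L t U) +
          (ν : ℂ) • (hubbardTorus 2 L t U - (Elo : ℂ) • 1) +
          (liebForm torusSign Gm w + liebFormFlip torusSign Gm' w' + R))) :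
    ∀ ψ : Fock (Orb (FermionTorus 2 L)), star ψ ⬝ᵥ ψ = 1 →
      IsGroundStateInSector (hubbardTorus 2 L t U) (L ^ 2) 0 ψ →
      c - δ ≤ (star ψ ⬝ᵥ V *ᵥ ψ).re := by
  classical
  intro ψ h1 hgs
  obtain ⟨hN, hHψ⟩ := halfFilled_sectorGS_eigen L hL t U hgs
  have hS := spinSq_mulVec_eq_zero_of_halfFilled_eigen L hL ht hU hN hHψ
  have hpos : ∀ x, 0 ≤ srState ψ (star x * x) := fun x => vectorState_nonneg ψ x
  have hone : srState ψ 1 = 1 := by rw [srState_apply, one_mulVec, h1]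
  have hn := srState_null_eq_zero L hN hS hHψ s X t' Y Y' a a'
  have hP : 0 ≤ (srState ψ (liebForm torusSign Gm w)).re := by
    rw [srState_apply]
    exact (Complex.nonneg_iff.mp (hubbardTorus_liebForm_expect_nonneg hL ht hU hN hHψ hGm w)).1
  have hP' : 0 ≤ (srState ψ (liebFormFlip torusSign Gm' w')).re := by
    rw [srState_apply]
    exact (Complex.nonneg_iff.mp
      (hubbardTorus_liebFormFlip_expect_nonneg hL ht hU hN hHψ hGm' w')).1
  have hRre := re_srState_ge_of_posSemidef_add h1 hR
  set E₀ : ℝ := groundEnergyAt (fermionTorusGraph 2 L) t U (L ^ 2) with hE₀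
  have hH : srState ψ (hubbardTorus 2 L t U) = (E₀ : ℂ) := by
    rw [srState_apply, hHψ, dotProduct_smul, h1, smul_eq_mul, mul_one]
  have hwin1 : (srState ψ ((μ : ℂ) • ((Eup : ℂ) • 1 - hubbardTorus 2 L t U))).re =
      μ * (Eup - E₀) := by
    rw [map_smul, map_sub, map_smul, hone, hH, smul_eq_mul, smul_eq_mul, mul_one,
      ← Complex.ofReal_sub, ← Complex.ofReal_mul, Complex.ofReal_re]
  have hwin2 : (srState ψ ((ν : ℂ) • (hubbardTorus 2 L t U - (Elo : ℂ) • 1))).re =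
      ν * (E₀ - Elo) := by
    rw [map_smul, map_sub, map_smul, hone, hH, smul_eq_mul, smul_eq_mul, mul_one,
      ← Complex.ofReal_sub, ← Complex.ofReal_mul, Complex.ofReal_re]
  have hw1 : 0 ≤ μ * (Eup - E₀) := mul_nonneg hμ (sub_nonneg.2 hup)
  have hw2 : 0 ≤ ν * (E₀ - Elo) := mul_nonneg hν (sub_nonneg.2 hlo)
  have hr : -δ ≤ (srState ψ ((μ : ℂ) • ((Eup : ℂ) • 1 - hubbardTorus 2 L t U) +
      (ν : ℂ) • (hubbardTorus 2 L t U - (Elo : ℂ) • 1) +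
      (liebForm torusSign Gm w + liebFormFlip torusSign Gm' w' + R))).re := by
    simp only [map_add, Complex.add_re]
    rw [hwin1, hwin2]
    linarith
  have h := le_re_map_of_certificate_residual (srState ψ) hpos hone hΛ O hn hr hcert
  rwa [srState_apply] at h

/-- Upper-bound form of `re_expect_halfFilledGS_ge_of_windowCertificate_liebGram`: a certificate
for `−V − c·1` proves `Re ⟨ψ, V ψ⟩ ≤ −c + δ`. [cite: LiebPRL1989, proof of Theorem 2]
[cite: WangEtAl2024, §3 eq. (4)] -/
theorem re_expect_halfFilledGS_le_of_windowCertificate_liebGram (hL : Even L) {t U : ℝ}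
    (ht : t ≠ 0) (hU : 0 < U) {Λm : Matrix m m ℂ} (hΛ : Λm.PosSemidef)
    (O : m → Matrix (Finset (Orb (FermionTorus 2 L))) (Finset (Orb (FermionTorus 2 L))) ℂ)
    {κ : Type*} (s : Finset κ)
    (X : κ → Matrix (Finset (Orb (FermionTorus 2 L))) (Finset (Orb (FermionTorus 2 L))) ℂ)
    {ι : Type*} (t' : Finset ι)
    (Y Y' : ι → Matrix (Finset (Orb (FermionTorus 2 L))) (Finset (Orb (FermionTorus 2 L))) ℂ)
    (a a' : ι → Fin 4)
    {κ₁ : Type*} [Fintype κ₁] {Gm : Matrix κ₁ κ₁ ℂ} (hGm : Gm.PosSemidef)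
    (w : κ₁ → List (FermionTorus 2 L × FermionTorus 2 L))
    {κ₂ : Type*} [Fintype κ₂] {Gm' : Matrix κ₂ κ₂ ℂ} (hGm' : Gm'.PosSemidef)
    (w' : κ₂ → List (FermionTorus 2 L × FermionTorus 2 L))
    {R : Matrix (Finset (Orb (FermionTorus 2 L))) (Finset (Orb (FermionTorus 2 L))) ℂ} {δ : ℝ}
    (hR : (R + (δ : ℂ) • (1 : Matrix (Finset (Orb (FermionTorus 2 L))) _ ℂ)).PosSemidef)
    {V : Matrix (Finset (Orb (FermionTorus 2 L))) (Finset (Orb (FermionTorus 2 L))) ℂ}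
    {Eup Elo μ ν c : ℝ} (hμ : 0 ≤ μ) (hν : 0 ≤ ν)
    (hup : groundEnergyAt (fermionTorusGraph 2 L) t U (L ^ 2) ≤ Eup)
    (hlo : Elo ≤ groundEnergyAt (fermionTorusGraph 2 L) t U (L ^ 2))
    (hcert : -V - (c : ℂ) • 1 =
      gramForm Λm O + (∑ k ∈ s, (hubbardTorus 2 L t U * X k - X k * hubbardTorus 2 L t U) +
        ∑ q ∈ t', (Y q * singletSectorAnn (L ^ 2) (a q) + singletSectorAnn (L ^ 2) (a' q) * Y' q)) +
        ((μ : ℂ) • ((Eup : ℂ) • 1 - hubbardTorus 2 L t U) +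
          (ν : ℂ) • (hubbardTorus 2 L t U - (Elo : ℂ) • 1) +
          (liebForm torusSign Gm w + liebFormFlip torusSign Gm' w' + R))) :
    ∀ ψ : Fock (Orb (FermionTorus 2 L)), star ψ ⬝ᵥ ψ = 1 →
      IsGroundStateInSector (hubbardTorus 2 L t U) (L ^ 2) 0 ψ →
      (star ψ ⬝ᵥ V *ᵥ ψ).re ≤ -c + δ := by
  intro ψ h1 hgs
  have h := re_expect_halfFilledGS_ge_of_windowCertificate_liebGram L hL ht hU hΛ O s X t' Y Y' a a'
    hGm w hGm' w' hR hμ hν hup hlo hcert ψ h1 hgs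
  rw [neg_mulVec, dotProduct_neg, Complex.neg_re] at h
  linarith

end Torus

end Summit.HubbardSuperconductivity.HubbardLadder
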